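import Literature.NumberTheory.EllipticCurves.IsogenyPotentiallyGoodMinimalDiscriminantProofs
import HarnessLib

/-!
# STUB `stub_dokchitserDokchitser` of skeleton v11 — PROVED BY NAME (route `EdixhovenFibreFiveSeven`, crux K★
# stmt-BirchSwinnertonDyer-22226, line `kato-lever`; seat `bsd-line-edix-p4` g29, width)

HONEST FRAMING. One theorem (no definition, no named fact, no instance, no `sorry`): the registered stub
`stub_dokchitserDokchitser` of skeleton v11 (`Cruxes/StarredOptimalManinUnitFiveSeven/Lines/kato_lever.lean`) BY NAME AND
SIGNATURE — Dokchitser–Dokchitser 2015 Thm. 5.1 (1), clause `l ≠ p`: a `ℚ`-isogeny of degree prime to `p` between globally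
minimal elliptic curves preserves `ord_p Δ_min` at a prime `p` of potentially good reduction (`0 ≤ ord_p j`). The skeleton
carried it as a cite-only published stub; the tree ALREADY holds its discharge
`Literature.NumberTheory.EllipticCurves.dokchitser_padicValInt_minimalDiscriminantInt_eq_of_isogeny_of_not_dvd_degree_holds`
(`Literature/NumberTheory/EllipticCurves/IsogenyPotentiallyGoodMinimalDiscriminantProofs.lean`: the printed proof — good
reduction of `W` over `ℚ(W[3])` / `ℚ(W[4])`, `w`-integrality of the transported multiplier `k·u′/u`, and the dual isogeny), so
this file is a one-line pointer. In the composition `StarredOptimalManinUnitFiveSeven_of` it moves the cell data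
(`ord_p Δ_min ∈ {8, 9, 10}`) from the optimal curve `W` to Kato's member `W′ ∼ W` (`…CellDataOfIsogenous.cellData_of_isIsogenous`).
The crux K★ stays OPEN ⟸ {P1-bar `stub_sl2NeronValues` (print XL), `stub_localFormulaOrdinaryCells`}; BSD is not proved by any
of this.

References: [DokchitserDokchitser2015LocalInvariants] Thm. 5.1 (1) (arXiv:1208.5519 Thm. 19 (1)), Table 1;
[SilvermanAEC2009] Prop. VII.5.5, Cor. VII.7.2.
-/

set_option autoImplicit false
-- single-conjunct summit: `Summit.BirchSwinnertonDyer.BirchSwinnertonDyer.…` repeats the name by design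
set_option linter.dupNamespace false

namespace Summit.BirchSwinnertonDyer.BirchSwinnertonDyer.Theorems.StarredOptimalManinUnitFiveSevenDokchitserDokchitser

/-- ★ **STUB `stub_dokchitserDokchitser` OF SKELETON v11, PROVED** — Dokchitser–Dokchitser 2015 Thm. 5.1 (1), clause
`l ≠ p`: for globally minimal elliptic `W, W′/ℚ`, a `ℚ`-isogeny `φ : W → W′` with `p ∤ deg φ` and `0 ≤ ord_p j(W)`,
`ord_p Δ_min(W) = ord_p Δ_min(W′)`; by the tree's discharge
`dokchitser_padicValInt_minimalDiscriminantInt_eq_of_isogeny_of_not_dvd_degree_holds`.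
[cite: DokchitserDokchitser2015LocalInvariants, Thm. 5.1 (1) (arXiv:1208.5519 Thm. 19 (1)) with Table 1]
[cite: SilvermanAEC2009, Cor. VII.7.2 and Prop. VII.5.5] -/
theorem stub_dokchitserDokchitser :
    Literature.NumberTheory.EllipticCurves.dokchitser_padicValInt_minimalDiscriminantInt_eq_of_isogeny_of_not_dvd_degree :=
  Literature.NumberTheory.EllipticCurves.dokchitser_padicValInt_minimalDiscriminantInt_eq_of_isogeny_of_not_dvd_degree_holds

end Summit.BirchSwinnertonDyer.BirchSwinnertonDyer.Theorems.StarredOptimalManinUnitFiveSevenDokchitserDokchitser
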